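import Literature.GroupTheory.CombinatorialGroupTheory.QuadraticSystemsGluingTietze
import HarnessLib

/-!
# Gluing the faces of a system of polygons, III: down to one face

Topic `Literature/GroupTheory/CombinatorialGroupTheory`; continues `QuadraticSystemsGluing.lean` and
`QuadraticSystemsGluingTietze.lean` (Zieschang–Vogt–Coldewey, LNM 835, §3.1).  **The iteration**
(`exists_one_face_of_sysPerm_transitive`, `…'`): a closed system of `n + 1` nonempty faces with
pairwise distinct letters and transitive vertex permutation is glued, along `n` edges with symbols
`D`, into ONE face `W` with one vertex (`VertexTransitive W`), whose letters are the letters of the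
system minus those with symbol in `D`; every symbol of `D` occurred; and
`⟨ι ∣ faces, S₀⟩ ≅ ⟨ι ∣ W, (x_i)_{i ∈ D}, S₀⟩` for every set `S₀` of extra relators avoiding `D`.
At each step the first face is glued to another face along an edge found by
`exists_glue_of_sysPerm_transitive`; the vertices are kept by `sysPerm_glue_transitive`
(`QuadraticSystems.lean`), the group by `presentedGroup_glue`; the degenerate last gluing
`[y] ∷ [ȳ] ↦ []` is treated separately.

This is the gluing stage [B2-GLUE] of the Reidemeister–Schreier computation of the finite-index
subgroups of surface groups (ZVC Thm. 4.14.22): fed with the lifted faces of a finite covering (tree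
edges killed, `S₀` = the tree generators), it yields the one-vertex quadratic word `W` whose
one-relator group is a surface group (`OneVertex.nonempty_presentedGroup_mulEquiv_surfaceGroup_of_card`
via `oneVertex_of_sameCycle`).  Theorems only.

## References

* H. Zieschang, E. Vogt, H.-D. Coldewey, *Surfaces and Planar Discontinuous Groups*, LNM 835,
  Springer 1980, §3.1 (3.1.6), 4.14.22. [ZieschangVogtColdewey1980]
-/

namespace Literature.GroupTheory.CombinatorialGroupTheory

open List Equiv Equiv.Perm

variable {ι : Type*} [DecidableEq ι]

/-! ### The iteration: gluing down to one face -/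

section Iterate

variable [Fintype ι]

omit [DecidableEq ι] [Fintype ι] in
/-- The face relators of a one-face system. [folklore] -/
private theorem faces_singleton_union (W : List (ι × Bool)) (S : Set (FreeGroup ι)) :
    (fun F => FreeGroup.mk F) '' {F | F ∈ [W]} ∪ S = {FreeGroup.mk W} ∪ S := by
  ext x
  simp only [Set.mem_union, Set.mem_image, Set.mem_setOf_eq, mem_cons, not_mem_nil, or_false,
    Set.mem_singleton_iff]
  constructor
  · rintro (⟨F, rfl, rfl⟩ | h)
    exacts [Or.inl rfl, Or.inr h]
  · rintro (rfl | h)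
    exacts [Or.inl ⟨W, rfl, rfl⟩, Or.inr h]

omit [Fintype ι] in
/-- Inserting a killed generator. [folklore] -/
private theorem rels_insert_eq (W : List (ι × Bool)) (D : Finset ι) (i : ι) (S : Set (FreeGroup ι)) :
    {FreeGroup.mk W} ∪ FreeGroup.of '' (↑D : Set ι) ∪ ({FreeGroup.of i} ∪ S) =
      {FreeGroup.mk W} ∪ FreeGroup.of '' (↑(insert i D) : Set ι) ∪ S := by
  rw [Finset.coe_insert, Set.image_insert_eq]
  ext x
  simp only [Set.mem_union, Set.mem_singleton_iff, Set.mem_insert_iff]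
  tauto

/-- **Gluing a connected system of polygons into one polygon** (ZVC 3.1.6, iterated; the gluing
stage of the Reidemeister–Schreier computation 4.14.22).  Let `Fs` be `n + 1` nonempty faces with
pairwise distinct letters, closed under partners, whose vertex permutation `sysPerm Fs` is
transitive on the letters.  Then there are ONE face `W` and a set `D` of `n` glued symbols with:
`W` has distinct letters, is closed, and is a ONE-VERTEX word (`VertexTransitive W`); the letters of
`W` are the letters of `Fs` whose symbol is not in `D`; every symbol of `D` occurred in `Fs`; and for
every set `S₀` of extra relators avoiding the symbols of `D`,
`⟨ι ∣ faces of Fs, S₀⟩ ≅ ⟨ι ∣ W, (x_i)_{i ∈ D}, S₀⟩`. [cite: ZieschangVogtColdewey1980, 3.1.6 / 4.14.22] -/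
theorem exists_one_face_of_sysPerm_transitive :
    ∀ (n : ℕ) (Fs : List (List (ι × Bool))), Fs.length = n + 1 → Fs.flatten.Nodup →
      Closed Fs.flatten → (∀ F ∈ Fs, F ≠ []) →
      (∀ x ∈ Fs.flatten, ∀ z ∈ Fs.flatten, (sysPerm Fs).SameCycle x z) →
      ∃ (W : List (ι × Bool)) (D : Finset ι), W.Nodup ∧ Closed W ∧ VertexTransitive W ∧
        (∀ x, x ∈ W ↔ x ∈ Fs.flatten ∧ x.1 ∉ D) ∧ (∀ i ∈ D, (i, true) ∈ Fs.flatten) ∧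
        D.card + 1 = Fs.length ∧
        ∀ S₀ : Set (FreeGroup ι), (∀ r ∈ S₀, ∀ i ∈ D, Avoids i r.toWord) →
          Nonempty (PresentedGroup ((fun F => FreeGroup.mk F) '' {F | F ∈ Fs} ∪ S₀) ≃*
            PresentedGroup ({FreeGroup.mk W} ∪ FreeGroup.of '' (↑D : Set ι) ∪ S₀))
  | 0, Fs, hlen, hd, hc, _, ht => by
    obtain ⟨W, rfl⟩ := length_eq_one_iff.1 hlen
    have hW : [W].flatten = W := by simp
    rw [hW] at hd hc ht
    refine ⟨W, ∅, hd, hc, ?_, fun x => by simp [hW], by simp, by simp, fun S₀ _ => ?_⟩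
    · intro x hx z hz
      rw [← sysPerm_singleton]
      exact ht x hx z hz
    · rw [faces_singleton_union, Finset.coe_empty, Set.image_empty, Set.union_empty]
      exact ⟨MulEquiv.refl _⟩
  | n + 1, Fs, hlen, hd, hc, hne, ht => by
    classical
    obtain ⟨Φ, rest, rfl⟩ : ∃ Φ rest, Fs = Φ :: rest :=
      exists_cons_of_ne_nil (by rintro rfl; simp at hlen)
    have hrest_len : rest.length = n + 1 := by simpa using hlen
    have hΦ : Φ ≠ [] := hne Φ mem_cons_self
    have hrest : ∃ F ∈ rest, F ≠ [] := by
      obtain ⟨F, rest', hr⟩ := exists_cons_of_ne_nil (show rest ≠ [] by rintro rfl; simp at hrest_len)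
      exact ⟨F, by simp [hr], hne F (by simp [hr])⟩
    obtain ⟨y, A₁, A₂, C₁, C₂, M, N, hΦeq, hresteq⟩ := exists_glue_of_sysPerm_transitive hd hc hΦ hrest ht
    subst hΦeq
    subst hresteq
    -- the normal form `src = (A y) ∷ (C ȳ) ∷ Gs` and the glued system `tgt = (A C) ∷ Gs`
    set A := A₂ ++ A₁ with hA
    set C := C₂ ++ C₁ with hC
    set Gs := M ++ N with hGs
    have hperm : ((A₁ ++ y :: A₂) :: (M ++ (C₁ ++ bar y :: C₂) :: N)).flatten ~
        ((A ++ [y]) :: (C ++ [bar y]) :: Gs).flatten := perm_flatten_glue_normal_form A₁ A₂ C₁ C₂ M N y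
    have hd' : ((A ++ [y]) :: (C ++ [bar y]) :: Gs).flatten.Nodup := hd.perm hperm
    have hc' : Closed ((A ++ [y]) :: (C ++ [bar y]) :: Gs).flatten := hc.of_perm hperm
    have hσ : sysPerm ((A₁ ++ y :: A₂) :: (M ++ (C₁ ++ bar y :: C₂) :: N)) =
        sysPerm ((A ++ [y]) :: (C ++ [bar y]) :: Gs) := sysPerm_eq_glue_normal_form A₁ A₂ C₁ C₂ M N y hd
    have ht' : ∀ x ∈ ((A ++ [y]) :: (C ++ [bar y]) :: Gs).flatten, ∀ z ∈ ((A ++ [y]) :: (C ++ [bar y]) :: Gs).flatten,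
        (sysPerm ((A ++ [y]) :: (C ++ [bar y]) :: Gs)).SameCycle x z := fun x hx z hz => by
      rw [← hσ]; exact ht x (hperm.mem_iff.2 hx) z (hperm.mem_iff.2 hz)
    have hd'' : ((A ++ C) :: Gs).flatten.Nodup := nodup_glue hd'
    have hc'' : Closed ((A ++ C) :: Gs).flatten := closed_glue hd' hc'
    have ht'' := sysPerm_glue_transitive hd' ht'
    -- faces of `Gs` are faces of `rest`, hence nonempty
    have hGs_ne : ∀ F ∈ Gs, F ≠ [] := fun F hF => by
      refine hne F (mem_cons_of_mem _ ?_)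
      rcases mem_append.1 hF with hF | hF
      · exact mem_append_left _ hF
      · exact mem_append_right _ (mem_cons_of_mem _ hF)
    -- the group side, common to both cases
    have hgrp : ∀ S₀ : Set (FreeGroup ι), (∀ r ∈ S₀, Avoids y.1 r.toWord) →
        Nonempty (PresentedGroup ((fun F => FreeGroup.mk F) ''
            {F | F ∈ (A₁ ++ y :: A₂) :: (M ++ (C₁ ++ bar y :: C₂) :: N)} ∪ S₀) ≃*
          PresentedGroup ((fun F => FreeGroup.mk F) '' {F | F ∈ (A ++ C) :: Gs} ∪ ({FreeGroup.of y.1} ∪ S₀))) :=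
      fun S₀ hS₀ => by
        obtain ⟨e₂⟩ := presentedGroup_glue hd' S₀ hS₀
        exact ⟨(QuotientGroup.quotientMulEquivOfEq
          (normalClosure_faces_glue_normal_form A₁ A₂ C₁ C₂ M N y S₀)).trans e₂⟩
    -- membership bookkeeping
    have hmem_tgt : ∀ x, x ∈ ((A ++ C) :: Gs).flatten ↔
        x ∈ ((A₁ ++ y :: A₂) :: (M ++ (C₁ ++ bar y :: C₂) :: N)).flatten ∧ x.1 ≠ y.1 := fun x => by
      rw [mem_glue_flatten_iff hd', hperm.mem_iff]
    have hy_true : (y.1, true) ∈ ((A₁ ++ y :: A₂) :: (M ++ (C₁ ++ bar y :: C₂) :: N)).flatten :=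
      hperm.mem_iff.2 (mem_glue_src_true y A C Gs)
    by_cases hAC : A ++ C = []
    · -- degenerate gluing: the system was `[y] ∷ [ȳ]`, glued into the empty face
      obtain ⟨hA0, hC0⟩ := append_eq_nil_iff.1 hAC
      have hGs0 : Gs = [] := by
        by_contra hGs
        obtain ⟨F, hF⟩ := exists_mem_of_ne_nil Gs hGs
        obtain ⟨z, hz⟩ := exists_mem_of_ne_nil F (hGs_ne F hF)
        -- the cycle of `y` is `{y, ȳ}`
        have hstab : ∀ w ∈ ({y, bar y} : Set (ι × Bool)),
            sysPerm ((A ++ [y]) :: (C ++ [bar y]) :: Gs) w ∈ ({y, bar y} : Set (ι × Bool)) := by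
          intro w hw
          simp only [Set.mem_insert_iff, Set.mem_singleton_iff] at hw ⊢
          rcases hw with hw | hw <;> rw [hw]
          · right
            rw [sysPerm_apply_of_bar_mem hd' (F := C ++ [bar y]) (by simp) (by simp), hC0]
            simp
          · left
            rw [sysPerm_apply_of_bar_mem hd' (F := A ++ [y]) (by simp) (by simp), hA0]
            simp
        have hzF : z ∈ ((A ++ [y]) :: (C ++ [bar y]) :: Gs).flatten := by
          rw [flatten_cons, flatten_cons]
          exact mem_append_right _ (mem_append_right _ (mem_flatten.2 ⟨F, hF, hz⟩))
        have hzy := SameCycle.mem_of_forall_apply_mem hstab (u := y) (by simp) (ht' y (by simp) z hzF)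
        have hz_tgt : z ∈ ((A ++ C) :: Gs).flatten := by
          rw [flatten_cons]; exact mem_append_right _ (mem_flatten.2 ⟨F, hF, hz⟩)
        simp only [Set.mem_insert_iff, Set.mem_singleton_iff] at hzy
        rcases hzy with rfl | rfl
        · exact not_mem_glue hd' hz_tgt
        · exact bar_not_mem_glue hd' hz_tgt
      have hMN : M = [] ∧ N = [] := append_eq_nil_iff.1 (hGs ▸ hGs0)
      have hn : n = 0 := by
        have : (M ++ (C₁ ++ bar y :: C₂) :: N).length = n + 1 := hrest_len
        rw [hMN.1, hMN.2] at this
        simpa using this.symm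
      refine ⟨[], {y.1}, nodup_nil, fun x hx => by simp at hx, vertexTransitive_nil, ?_, ?_, ?_, ?_⟩
      · intro x
        simp only [not_mem_nil, Finset.mem_singleton, false_iff, not_and, not_not]
        intro hx
        by_contra hxy
        have := (hmem_tgt x).2 ⟨hx, hxy⟩
        rw [hAC, hGs0] at this
        simp at this
      · intro i hi
        rw [Finset.mem_singleton] at hi
        subst hi
        exact hy_true
      · rw [Finset.card_singleton, length_cons, hrest_len, hn]
      · intro S₀ hS₀
        obtain ⟨e⟩ := hgrp S₀ fun r hr => hS₀ r hr y.1 (Finset.mem_singleton_self _)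
        refine ⟨e.trans (QuotientGroup.quotientMulEquivOfEq ?_)⟩
        rw [hAC, hGs0, faces_singleton_union, Finset.coe_singleton, Set.image_singleton, Set.union_assoc]
    · -- generic gluing: recurse on the glued system
      have hne'' : ∀ F ∈ (A ++ C) :: Gs, F ≠ [] := by
        intro F hF
        rcases mem_cons.1 hF with rfl | hF
        · exact hAC
        · exact hGs_ne F hF
      have hlen'' : ((A ++ C) :: Gs).length = n + 1 := by
        have : (M ++ (C₁ ++ bar y :: C₂) :: N).length = n + 1 := hrest_len
        simp only [length_append, length_cons] at this
        simp only [hGs, length_cons, length_append]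
        omega
      obtain ⟨W, D', hWd, hWc, hWt, hWmem, hD'mem, hD'card, hD'iso⟩ :=
        exists_one_face_of_sysPerm_transitive n ((A ++ C) :: Gs) hlen'' hd'' hc'' hne'' ht''
      have hyD' : y.1 ∉ D' := fun h => ((mem_glue_flatten_iff hd').1 (hD'mem _ h)).2 rfl
      refine ⟨W, insert y.1 D', hWd, hWc, hWt, ?_, ?_, ?_, ?_⟩
      · intro x
        rw [hWmem x, hmem_tgt x, Finset.mem_insert, not_or, and_assoc]
      · intro i hi
        rcases Finset.mem_insert.1 hi with rfl | hi
        · exact hy_true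
        · exact hperm.mem_iff.2 (((mem_glue_flatten_iff hd').1 (hD'mem i hi)).1)
      · rw [Finset.card_insert_of_notMem hyD', length_cons, hrest_len, ← hlen'', ← hD'card]
      · intro S₀ hS₀
        have hS₀y : ∀ r ∈ S₀, Avoids y.1 r.toWord := fun r hr => hS₀ r hr y.1 (Finset.mem_insert_self _ _)
        obtain ⟨e₁₂⟩ := hgrp S₀ hS₀y
        have hS₀' : ∀ r ∈ ({FreeGroup.of y.1} ∪ S₀ : Set (FreeGroup ι)), ∀ i ∈ D', Avoids i r.toWord := by
          rintro r (hr | hr) i hi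
          · rw [Set.mem_singleton_iff] at hr
            subst hr
            rw [FreeGroup.toWord_of]
            intro x hx
            rw [mem_singleton] at hx
            subst hx
            exact fun h => hyD' (h ▸ hi)
          · exact hS₀ r hr i (Finset.mem_insert_of_mem hi)
        obtain ⟨e₃⟩ := hD'iso ({FreeGroup.of y.1} ∪ S₀) hS₀'
        exact ⟨e₁₂.trans (e₃.trans (QuotientGroup.quotientMulEquivOfEq (by rw [rels_insert_eq])))⟩

/-- **Gluing a connected system of polygons into one polygon**, stated for a nonempty system (the
form consumed by the Reidemeister–Schreier computation of finite-index subgroups of surface groups,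
ZVC 4.14.22): see `exists_one_face_of_sysPerm_transitive`. [cite: ZieschangVogtColdewey1980, 3.1.6 / 4.14.22] -/
theorem exists_one_face_of_sysPerm_transitive' (Fs : List (List (ι × Bool))) (hFs : Fs ≠ [])
    (hd : Fs.flatten.Nodup) (hc : Closed Fs.flatten) (hne : ∀ F ∈ Fs, F ≠ [])
    (ht : ∀ x ∈ Fs.flatten, ∀ z ∈ Fs.flatten, (sysPerm Fs).SameCycle x z) :
    ∃ (W : List (ι × Bool)) (D : Finset ι), W.Nodup ∧ Closed W ∧ VertexTransitive W ∧
      (∀ x, x ∈ W ↔ x ∈ Fs.flatten ∧ x.1 ∉ D) ∧ (∀ i ∈ D, (i, true) ∈ Fs.flatten) ∧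
      D.card + 1 = Fs.length ∧
      ∀ S₀ : Set (FreeGroup ι), (∀ r ∈ S₀, ∀ i ∈ D, Avoids i r.toWord) →
        Nonempty (PresentedGroup ((fun F => FreeGroup.mk F) '' {F | F ∈ Fs} ∪ S₀) ≃*
          PresentedGroup ({FreeGroup.mk W} ∪ FreeGroup.of '' (↑D : Set ι) ∪ S₀)) :=
  exists_one_face_of_sysPerm_transitive (Fs.length - 1) Fs
    (by have := length_pos_of_ne_nil hFs; omega) hd hc hne ht

end Iterate

end Literature.GroupTheory.CombinatorialGroupTheory
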